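import Summits.Schanuel.Schanuel.Theorems.ZilberEacRealSplitParam
import Mathlib.Algebra.MvPolynomial.Funext
import Mathlib.Topology.Algebra.MvPolynomial
import HarnessLib

/-!
# Totally real hyperplane × parametrised curve: Zariski density in ALL dimensions

Zilber's Exponential-Algebraic Closedness, case ladder (host summit Schanuel, cell `pub-schanuel`,
seat 2, gen 7).  The general form of `ZilberEacRealSplitDensity` / `ZilberEacRealSplitParam`:

**THEOREM (`unprojectedDense_realSplitParam_all`).**  Let `s ≥ 0`, `r ∈ ℝ^{s+1}` with `r_last`
irrational, `c ∈ ℂ`, nonzero `q₀, …, q_s, p₀ ∈ ℂ[t]` with `deg p₀ ≠ Σⱼ rⱼ deg qⱼ`.  Then the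
exponential points of the `(s+2)`-fold
`W = {(x, Σⱼ rⱼ xⱼ + c ; q₀(t), …, q_s(t), p₀(t)) : x ∈ ℂ^{s+1}, t ∈ ℂ} ⊆ ℂ^{s+2} × ℂ^{s+2}`
(totally real affine hyperplane × polynomially parametrised curve) are ZARISKI DENSE in `W`:
`I(W ∩ Γ_exp) = I(W)`.

Proof: the parametrised open-mapping engine `realParam_core` with escaping coordinate `x_last` and
PRESCRIBED lattice shifts `2πiκⱼ` in the other coordinates gives, for every `α` in an infinite set
`A` and every `κ ∈ ℤˢ`, exponential points with `t → α`, `xⱼ → Λⱼ(α) + 2πiκⱼ` (`j < s`),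
`|x_last| → ∞`.  A polynomial vanishing on `W ∩ Γ_exp` pulls back to `G ∈ R[x_last]`,
`R = ℂ[t, x₀, …, x_{s-1}]`; its leading coefficient then vanishes at `(α, Λ(α) + 2πiκ)` for all
`α ∈ A`, `κ ∈ ℤˢ` (`map_leadingCoeff_eq_zero_of_eval₂_eq_zero`); for fixed `α` that is a box with
infinite sides (Mathlib `MvPolynomial.funext_set`), then each `t`-coefficient has the infinitely many
roots `A` (`eq_zero_of_forall_eval_cons_shift_eq_zero`); so `G = 0`.

**HONEST FRAMING.** Explicit families (existence ⊂ Gallinaro 2023 Thm 8.8 in print; density and the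
method new); nothing here bears on Schanuel's conjecture; `ECCell 3 2` OPEN.
-/

noncomputable section

open MvPolynomial Filter Topology Complex Metric
open Literature.NumberTheory.Transcendental Literature.ModelTheory.Zilber
  Literature.ModelTheory.ExponentialFields

set_option linter.dupNamespace false

namespace Summit.Schanuel.Schanuel.Theorems

section ElimAll

variable {s : ℕ}

/-- **Elimination over a family of lattice-translate boxes.** A polynomial
`H ∈ ℂ[t, x₀, …, x_{s-1}]` (variable `0` is `t`, variable `succ i` is `xᵢ`) vanishing at
`(α, Λ(α) + 2πiκ)` for all `α` in an infinite set and all `κ ∈ ℤˢ` is zero. -/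
theorem eq_zero_of_forall_eval_cons_shift_eq_zero (H : MvPolynomial (Fin (s + 1)) ℂ)
    {A : Set ℂ} (hA : A.Infinite) (Λ : Fin s → ℂ → ℂ)
    (h : ∀ α ∈ A, ∀ κ : Fin s → ℤ,
      MvPolynomial.eval (Fin.cons α (fun i => Λ i α + (κ i : ℂ) * (2 * Real.pi * I)) :
        Fin (s + 1) → ℂ) H = 0) : H = 0 := by
  classical
  apply (finSuccEquiv ℂ s).injective
  rw [map_zero]
  set Q := finSuccEquiv ℂ s H with hQ
  -- Step A: for each `α ∈ A`, `Q(C α) = 0` in `ℂ[x₀, …, x_{s-1}]` (a box with infinite sides)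
  have hA' : ∀ α ∈ A, Polynomial.eval (C α) Q = 0 := by
    intro α hα
    refine MvPolynomial.funext_set (fun i => Set.range fun k : ℤ => Λ i α + (k : ℂ) * (2 * Real.pi * I))
      (fun i => Set.infinite_range_of_injective fun k₁ k₂ hk => ?_) fun x hx => ?_
    · have h1 := add_left_cancel hk
      have h2 := mul_right_cancel₀ two_pi_I_ne_zero h1
      exact_mod_cast h2
    · rw [map_zero]
      choose κ hκ using fun i => hx i (Set.mem_univ i)
      have hxκ : x = fun i => Λ i α + (κ i : ℂ) * (2 * Real.pi * I) := funext fun i => (hκ i).symm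
      have h1 := h α hα κ
      rw [eval_eq_eval_mv_eval', ← hxκ, Polynomial.eval_map, ← hQ] at h1
      have h2 : (MvPolynomial.eval x) (Polynomial.eval (C α) Q) =
          Polynomial.eval₂ (MvPolynomial.eval x) α Q := by
        rw [← Polynomial.eval₂_at_apply, MvPolynomial.eval_C]
      rw [h2, h1]
  -- Step B: `Q(C α) = 0` for infinitely many `α` forces `Q = 0`, coefficient by coefficient
  ext i m
  rw [Polynomial.coeff_zero, MvPolynomial.coeff_zero]
  set P : Polynomial ℂ := ∑ k ∈ Finset.range (Q.natDegree + 1),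
    Polynomial.C (MvPolynomial.coeff m (Q.coeff k)) * Polynomial.X ^ k with hP
  have hPeval : ∀ α, P.eval α = MvPolynomial.coeff m (Polynomial.eval (C α) Q) := by
    intro α
    rw [hP, Polynomial.eval_finsetSum, Polynomial.eval_eq_sum_range, MvPolynomial.coeff_sum]
    refine Finset.sum_congr rfl fun k _ => ?_
    rw [Polynomial.eval_mul, Polynomial.eval_C, Polynomial.eval_pow, Polynomial.eval_X,
      ← map_pow, mul_comm (Q.coeff k), MvPolynomial.coeff_C_mul, mul_comm]
  have hP0 : P = 0 := by
    refine Polynomial.eq_zero_of_infinite_isRoot _ (hA.mono fun α hα => ?_)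
    simp only [Set.mem_setOf_eq, Polynomial.IsRoot, hPeval, hA' α hα, MvPolynomial.coeff_zero]
  have hPcoeff : ∀ k, P.coeff k = if k < Q.natDegree + 1 then MvPolynomial.coeff m (Q.coeff k) else 0 := by
    intro k
    rw [hP, Polynomial.finsetSum_coeff]
    simp only [Polynomial.coeff_C_mul, Polynomial.coeff_X_pow, mul_ite, mul_one, mul_zero,
      Finset.sum_ite_eq, Finset.mem_range]
  by_cases hi : i < Q.natDegree + 1
  · have := hPcoeff i
    rw [hP0, Polynomial.coeff_zero, if_pos hi] at this
    exact this.symm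
  · rw [Polynomial.coeff_eq_zero_of_natDegree_lt (by omega), MvPolynomial.coeff_zero]

end ElimAll

/-! ## Density in all dimensions -/

section DensityAll

variable {s : ℕ}

/-- **THEOREM (Zariski density, totally real hyperplane × parametrised curve, all dimensions).**
See the module docstring. -/
theorem unprojectedDense_realSplitParam_all (r : Fin (s + 1) → ℝ)
    (hr : Irrational (r (Fin.last s))) (c : ℂ) {q : Fin (s + 1) → Polynomial ℂ} (hq : ∀ j, q j ≠ 0)
    {p₀ : Polynomial ℂ} (hp₀ : p₀ ≠ 0)
    (hdeg : (p₀.natDegree : ℝ) ≠ ∑ j, r j * ((q j).natDegree : ℝ)) :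
    UnprojectedDense {z : Fin (s + 2) ⊕ Fin (s + 2) → ℂ | ∃ (x : Fin (s + 1) → ℂ) (t : ℂ),
      z = Sum.elim (Fin.snoc x (∑ j, (r j : ℂ) * x j + c))
        (Fin.snoc (fun j => (q j).eval t) (p₀.eval t))} := by
  classical
  set W := {z : Fin (s + 2) ⊕ Fin (s + 2) → ℂ | ∃ (x : Fin (s + 1) → ℂ) (t : ℂ),
      z = Sum.elim (Fin.snoc x (∑ j, (r j : ℂ) * x j + c))
        (Fin.snoc (fun j => (q j).eval t) (p₀.eval t))} with hW
  set pt : (Fin (s + 1) → ℂ) → ℂ → Fin (s + 2) ⊕ Fin (s + 2) → ℂ := fun x t =>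
    Sum.elim (Fin.snoc x (∑ j, (r j : ℂ) * x j + c)) (Fin.snoc (fun j => (q j).eval t) (p₀.eval t))
    with hpt
  have hptW : ∀ x t, pt x t ∈ W := fun x t => ⟨x, t, rfl⟩
  have hptΓ : ∀ x t, (∀ j, exp (x j) = (q j).eval t) →
      exp (∑ j, (r j : ℂ) * x j + c) = p₀.eval t → pt x t ∈ expGraph ℂ (s + 2) := by
    intro x t h0 h1
    rw [mem_expGraph_iff]
    intro i
    refine Fin.lastCases ?_ (fun j => ?_) i
    · simp [hpt, ExponentialRing.complex_exp_eq, h1]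
    · simp [hpt, ExponentialRing.complex_exp_eq, h0 j]
  -- the pull-back ring `R = ℂ[t, x₀, …, x_{s-1}]` (variable `0` = `t`, `succ i` = `xᵢ`), outer `x_last`
  set CC : ℂ →+* Polynomial (MvPolynomial (Fin (s + 1)) ℂ) := Polynomial.C.comp MvPolynomial.C
    with hCC
  set xsym : Fin (s + 1) → Polynomial (MvPolynomial (Fin (s + 1)) ℂ) :=
    Fin.snoc (fun i : Fin s => Polynomial.C (X (Fin.succ i))) Polynomial.X with hxsym
  set σ : Fin (s + 2) ⊕ Fin (s + 2) → Polynomial (MvPolynomial (Fin (s + 1)) ℂ) :=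
    Sum.elim (Fin.snoc xsym (∑ j, CC (r j : ℂ) * xsym j + CC c))
      (Fin.snoc (fun j => Polynomial.C (Polynomial.aeval (X 0 : MvPolynomial (Fin (s + 1)) ℂ) (q j)))
        (Polynomial.C (Polynomial.aeval (X 0 : MvPolynomial (Fin (s + 1)) ℂ) p₀))) with hσ
  set ev : ℂ → (Fin s → ℂ) → ℂ → Polynomial (MvPolynomial (Fin (s + 1)) ℂ) →+* ℂ :=
    fun t x' xl => Polynomial.eval₂RingHom (MvPolynomial.eval (Fin.cons t x' : Fin (s + 1) → ℂ)) xl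
    with hev
  have hevC : ∀ t x' xl, (ev t x' xl).comp CC = RingHom.id ℂ := by
    intro t x' xl
    ext a
    simp [hev, hCC]
  have hevx : ∀ t x' xl j, ev t x' xl (xsym j) = (Fin.snoc x' xl : Fin (s + 1) → ℂ) j := by
    intro t x' xl j
    refine Fin.lastCases ?_ (fun i => ?_) j
    · simp [hev, hxsym]
    · simp [hev, hxsym]
  have hevσ : ∀ t x' xl, (fun i => ev t x' xl (σ i)) = pt (Fin.snoc x' xl) t := by
    intro t x' xl
    funext i
    rcases i with k | k
    · refine Fin.lastCases ?_ (fun j => ?_) k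
      · simp only [hσ, hpt, Sum.elim_inl, Fin.snoc_last, map_add, map_sum, map_mul, hevx]
        congr 1
        · refine Finset.sum_congr rfl fun j _ => ?_
          congr 1
          have := DFunLike.congr_fun (hevC t x' xl) (r j : ℂ)
          simpa using this
        · have := DFunLike.congr_fun (hevC t x' xl) c
          simpa using this
      · simp only [hσ, hpt, Sum.elim_inl, Fin.snoc_castSucc, hevx]
    · refine Fin.lastCases ?_ (fun j => ?_) k
      · simp [hσ, hpt, hev, eval_polynomial_aeval_X]
      · simp [hσ, hpt, hev, eval_polynomial_aeval_X]
  refine le_antisymm ?_ (vanishingIdeal_anti_mono Set.inter_subset_left)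
  intro F hF
  set G : Polynomial (MvPolynomial (Fin (s + 1)) ℂ) := MvPolynomial.eval₂Hom CC σ F with hG
  have hGeval : ∀ t x' xl, ev t x' xl G = MvPolynomial.eval (pt (Fin.snoc x' xl) t) F := by
    intro t x' xl
    have h1 := DFunLike.congr_fun (MvPolynomial.comp_eval₂Hom CC σ (ev t x' xl)) F
    rw [RingHom.comp_apply, hevC, hevσ] at h1
    rw [hG, h1]
    rfl
  -- a level point and the engine with escaping coordinate `last`
  obtain ⟨t₀, ht₀, hqt₀, hlev⟩ := exists_splitParamLevelPoint r c hq hp₀ hdeg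
  obtain ⟨A, Λ, hA, hcore⟩ := realParam_core r (j₀ := Fin.last s) hr c hdeg ht₀ hqt₀ hlev
  have hG0 : G = 0 := by
    by_contra hGne
    have hlc : G.leadingCoeff ≠ 0 := Polynomial.leadingCoeff_ne_zero.2 hGne
    refine hlc (eq_zero_of_forall_eval_cons_shift_eq_zero _ hA (fun i => Λ (Fin.castSucc i))
      fun α hα κ => ?_)
    obtain ⟨x, w, hxl, hw, hxlim, hpts⟩ := hcore α hα (Fin.snoc κ 0)
    -- convergence of the inner coordinates `(t, x')`
    have hlim : Tendsto (fun n => (Fin.cons (w n) (fun i => x n (Fin.castSucc i)) : Fin (s + 1) → ℂ))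
        atTop (𝓝 (Fin.cons α (fun i => Λ (Fin.castSucc i) α + (κ i : ℂ) * (2 * Real.pi * I)))) := by
      rw [tendsto_pi_nhds]
      intro k
      refine Fin.cases ?_ (fun i => ?_) k
      · simpa using hw
      · have h1 := hxlim (Fin.castSucc i) (ne_of_lt (Fin.castSucc_lt_last i))
        simp only [Fin.snoc_castSucc] at h1
        simpa using h1
    refine map_leadingCoeff_eq_zero_of_eval₂_eq_zero G
      (fun n => MvPolynomial.eval (Fin.cons (w n) (fun i => x n (Fin.castSucc i)) : Fin (s + 1) → ℂ))
      (MvPolynomial.eval (Fin.cons α (fun i => Λ (Fin.castSucc i) α + (κ i : ℂ) * (2 * Real.pi * I))))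
      (fun P => ((MvPolynomial.continuous_eval P).tendsto _).comp hlim)
      (fun n => x n (Fin.last s)) hxl fun n => ?_
    have h2 := hGeval (w n) (fun i => x n (Fin.castSucc i)) (x n (Fin.last s))
    simp only [hev, Polynomial.coe_eval₂RingHom] at h2
    rw [h2]
    have hsnoc : (Fin.snoc (fun i => x n (Fin.castSucc i)) (x n (Fin.last s)) : Fin (s + 1) → ℂ) =
        x n := Fin.snoc_init_self _
    rw [hsnoc]
    exact eval_eq_zero_of_mem_vanishingIdeal hF ⟨hptW _ _, hptΓ _ _ (hpts n).1 (hpts n).2⟩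
  refine mem_vanishingIdeal_of_eval fun z hz => ?_
  obtain ⟨x, t, rfl⟩ := hz
  have h := hGeval t (fun i => x (Fin.castSucc i)) (x (Fin.last s))
  have hsnoc : (Fin.snoc (fun i => x (Fin.castSucc i)) (x (Fin.last s)) : Fin (s + 1) → ℂ) = x :=
    Fin.snoc_init_self _
  rw [hG0, map_zero, hsnoc] at h
  exact h.symm

end DensityAll

end Summit.Schanuel.Schanuel.Theorems

end
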